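import Literature.Probability.LatticeModels.SharpnessProofs

/-!
# Negative lemma for line `sup-axis-reflection-transfer` (crux `stmt-QuantumFields-9442`), STUB 3

`ShellSummation` (= registered stub `stub_shellSummation`) with the hypothesis `∀ j, 0 ≤ g j` deleted (the
statement negated below, otherwise verbatim) is FALSE: the cubic-moment budget `∑ (j+1)³ g j ≤ M` no longer controls the individual lag windows, because a
single huge negative weight at a lag `j < n₀` (never inside a window of a shell `‖x‖∞ ≥ n₀`) pays for positive
weights `g j = 1` on every other lag. So any proof of the stub must use `g ≥ 0` (it is load-bearing), while
`0 ≤ c` is not (for `c < 0` the domination hypothesis forces `f = 0` on the shells `‖x‖∞ ≥ n₀`).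
drefute seat `refuter-drefute-stmt-QuantumFields-9442-0`, 2026-08-16.
-/

noncomputable section

open Finset
open scoped BigOperators

namespace Summit.QuantumFields.YangMills.Theorems.FiniteSusceptibilityWeakCoupling.Negative

open Literature.Probability.LatticeModels

/-- **`g ≥ 0` is load-bearing in STUB 3.** Witness: `n₀ = 1`, `w = 0`, `K = c = 1`, `M = 0`; against a
proposed `C` take the torus parameter `S = ⌈C⌉₊ + 1`, `f ≡ 1`, `g 0 = -T`, `g j = 1 (j ≥ 1)` with
`T = ∑_{1 ≤ j ≤ S} (j+1)³`: all hypotheses hold and `∑_{box 4 S} |f| = (2S+1)⁴ > C`. [folklore] -/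
theorem shellSummation_false_without_gNonneg : ¬ (
  ∀ (n₀ w : ℕ) (K c M : ℝ), ∃ C : ℝ, ∀ (S : ℕ) (f : Literature.Probability.LatticeModels.Site 4 → ℝ)
    (g : ℕ → ℝ), 0 ≤ c → (∀ x ∈ box 4 S, |f x| ≤ K) →
    ∑ j ∈ Finset.range (S + 1), ((j : ℝ) + 1) ^ 3 * g j ≤ M →
    (∀ x ∈ box 4 S, n₀ ≤ Site.supNorm x →
      |f x| ≤ c * ∑ j ∈ (Finset.range (S + 1)).filter
          (fun j => Site.supNorm x ≤ j + w ∧ j ≤ Site.supNorm x + w), g j) →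
    ∑ x ∈ box 4 S, |f x| ≤ C) := by
  intro h
  obtain ⟨C, hC⟩ := h 1 0 1 1 0
  set S : ℕ := ⌈C⌉₊ + 1 with hS
  set T : ℝ := ∑ j ∈ (Finset.range (S + 1)).erase 0, ((j : ℝ) + 1) ^ 3 with hT
  set g : ℕ → ℝ := fun j => if j = 0 then -T else 1 with hg
  have hmom : ∑ j ∈ Finset.range (S + 1), ((j : ℝ) + 1) ^ 3 * g j ≤ 0 := by
    have h0 : (0 : ℕ) ∈ Finset.range (S + 1) := by simp
    rw [← Finset.add_sum_erase _ _ h0]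
    have hrest : ∑ j ∈ (Finset.range (S + 1)).erase 0, ((j : ℝ) + 1) ^ 3 * g j = T := by
      rw [hT]
      refine Finset.sum_congr rfl fun j hj => ?_
      have hj0 : j ≠ 0 := (Finset.mem_erase.1 hj).1
      simp [hg, hj0]
    rw [hrest]
    simp [hg]
  have hdom : ∀ x ∈ box 4 S, 1 ≤ Site.supNorm x →
      |(fun _ : Literature.Probability.LatticeModels.Site 4 => (1 : ℝ)) x| ≤
        1 * ∑ j ∈ (Finset.range (S + 1)).filter
          (fun j => Site.supNorm x ≤ j + 0 ∧ j ≤ Site.supNorm x + 0), g j := by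
    intro x hx hn
    have hxS : Site.supNorm x ≤ S := mem_box_iff_supNorm_le.1 hx
    have hfilter : (Finset.range (S + 1)).filter
        (fun j => Site.supNorm x ≤ j + 0 ∧ j ≤ Site.supNorm x + 0) = {Site.supNorm x} := by
      ext j
      simp only [Finset.mem_filter, Finset.mem_range, Finset.mem_singleton, add_zero]
      omega
    rw [hfilter, Finset.sum_singleton]
    have hne : Site.supNorm x ≠ 0 := by omega
    simp [hg, hne]
  have hbd : ∀ x ∈ box 4 S, |(fun _ : Literature.Probability.LatticeModels.Site 4 => (1 : ℝ)) x| ≤ 1 := by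
    intro x _; simp
  have key := hC S (fun _ => 1) g zero_le_one hbd hmom hdom
  have hsum : ∑ x ∈ box 4 S, |(fun _ : Literature.Probability.LatticeModels.Site 4 => (1 : ℝ)) x| =
      ((2 * S + 1) ^ 4 : ℕ) := by
    simp [Finset.sum_const, card_box]
  rw [hsum] at key
  have hSC : C < ((2 * S + 1) ^ 4 : ℕ) := by
    have h1 : C ≤ ⌈C⌉₊ := Nat.le_ceil C
    have h2 : (⌈C⌉₊ : ℝ) < S := by rw [hS]; push_cast; linarith
    have h3 : (S : ℝ) ≤ ((2 * S + 1) ^ 4 : ℕ) := by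
      have : S ≤ (2 * S + 1) ^ 4 := by
        calc S ≤ 2 * S + 1 := by omega
          _ = (2 * S + 1) ^ 1 := (pow_one _).symm
          _ ≤ (2 * S + 1) ^ 4 := Nat.pow_le_pow_right (by omega) (by omega)
      exact_mod_cast this
    linarith
  linarith

end Summit.QuantumFields.YangMills.Theorems.FiniteSusceptibilityWeakCoupling.Negative

end
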